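import Mathlib
import HarnessLib
import HarnessLib.Audit
import Summits.HodgeConjecture.HodgeConjecture.Statement
import Literature.AlgebraicGeometry.HodgeTheory.HodgeConjecture
import Literature.AlgebraicGeometry.HodgeTheory.ComplexConjugation
import Literature.AlgebraicGeometry.HodgeTheory.HodgeFiltration
import Literature.Geometry.Kaehler.HolomorphicChartForms
import Literature.AlgebraicTopology.SingularHomology.CupProduct

/-!
Route: EvenB2Twistor

CLOSED (retired) 2026-08-15T13:48:14Z by operator:999:1257524 — reason: not-a-thesis: assembly does not conclude the sub-problem Statement — note: D-0027 §2.1 audit (human 2026-08-15: routes that do not decide the summit are removed): the assembly concludes `Target`, not the sub-problem statement; a NEW conforming route may be opened from the same idea (generated `closes : … → _root_.HodgeConjecture`).. The file is kept as the record of this route; refuted decls are indexed as negative knowledge (`ledger negatives`).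

Route EvenB2Twistor — realises idea card even-b2-e-twistor-real-multiplication ("Even b2 trick:
carry real multiplication through non-projective K3s on E-stable twistor lines via hyperholomorphic
bundles").
It suffices to show X = `Target`: for every complex projective K3 surface S (smooth projective
surface, H^1 = 0, nowhere-vanishing holomorphic 2-form) and every E-STRUCTURE J on H^2(S,Q) — a
rational, cup-self-adjoint endomorphism with J∘J = m (m a non-square natural number) acting as
+sqrt(m) on H^{2,0}, i.e. real multiplication by E = Q(sqrt m) on T(S) extended self-adjointly to
NS(S) — such that End_Hdg(T(S)) = Q + Q·J|_T modulo NS (exactness EX) and the +sqrt(m)-eigenspace of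
J meets NS(S)_R in a vector of positive square (transfer condition TC), the Hodge conjecture holds
for S x S: `HodgeConjectureFor 4 (S ⊗ S)`. Equivalently: the Kuenneth class of sqrt(m) in
End_Hdg(T(S)) ⊂ H^4(S x S, Q) is algebraic — the first open (2,2)-classes "of K3 type"
(arXiv:2203.09778: for Picard number 16 known only on the two Kuga–Satake-algebraic 4-dimensional
families; CM case known by arXiv:1510.02852 / arXiv:1705.04063).
Lean: decl `Target` of this route file, stated on the REAL carriers (complexBetti, IsRationalClass,
IsIntegralClass, IsOfHodgeType, algebraicClasses, SingularHomology.cupProduct, conjClass,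
HodgeConjectureFor, MonoidalCategoryStruct.tensorObj); all decls elaborate (planner Sketch.lean,
lean check rc 0, 2026-08-15). Frame: `TargetOfHodgeConjecture : HodgeConjecture → Target` (support,
PROVED in Sketch.lean via IsSmoothProjective.tensor_holds) records that X is an instance family of
the summit; X → HodgeConjecture is of course not claimed (regime route). Assembly `IsogenyInvariance
→ CMAnchor → HighPicardSquares → Target` is pure logic (PROVED in Sketch.lean).
Mechanism (two layers; crux statements first, glue later): because b_2(K3) = 22 is even, H^2(S,Q) =
T ⊕ NS carries a self-adjoint E-structure J; on the E-period domain D_E (sigma in the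
+sqrt(m)-eigenspace, signature (3,8); arXiv:2511.19970 Cor 11.4 / Thm 7.1) J stays Hodge, and
twistor lines whose positive 3-plane W lies in that eigenspace keep the Kuenneth class y·J + x[Δ]
SU(2)_W-invariant; a mu-stable bundle with such c_2 at a CM anchor (Picard number 18, where HC(S0 x
S0) is known) is hyperholomorphic (Verbitsky, alg-geom/9307008 Thm 2.5), walks along chains of
E-twistor lines through K3 surfaces with NS = 0 (where stability is Kaehler-class independent and
Hodge classes on S_t x S_t are Q[Δ] + Q·J + fibres), and lands on S x S as a holomorphic, hence
algebraic, bundle whose c_2 contains y·sqrt(m), y ≠ 0.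

Rationale: WHY THIS LINE. Buskin (arXiv:1510.02852) and Huybrechts (arXiv:1705.04063) made every rational Hodge
ISOMETRY of K3 surfaces algebraic — Buskin by transporting hyperholomorphic sheaves along twistor
paths (engine: Verbitsky alg-geom/9307008 Thm 2.5; also Markman doi:10.1112/s0010437x24007048 for
K3^[n]-type). The totally real part End_Hdg(T(S)) ∋ sqrt(m) is untouched: Huybrechts
(arXiv:1910.13788, §1) notes RM classes do NOT deform along (ordinary) twistor lines. Import from
hyperkaehler/gauge geometry with an explicit dictionary: E-structure J on all of H^2 (22 = 2·11) ↦
sub-period-domain D_E where J is Hodge (now a theorem: Bayer-Fluckiger–van Geemen–Schuett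
arXiv:2511.19970 Cor 11.4, Thm 7.1, Thm 1.3: a 9-dim family of K3 of algebraic dimension 0 with End
= Q(sqrt m)); irrational Kaehler class kappa in the +sqrt(m)-eigenspace ↦ twistor SU(2) commuting
with J ↦ Kuenneth class of J is SU(2)-invariant ↦ Verbitsky: stable + invariant c_1,c_2 ⇒
hyperholomorphic ⇒ transport; projective endpoint ↦ GAGA. Planner's audit added: take kappa_0
GENERIC in E_+ ∩ Amp(S0)_R so that every intermediate node has NS = 0 (Kaehler cone = positive cone,
slope-stability automatic: all c_1 vanish) — this removes the node-stability risk; anchors exist in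
EVERY E-isometry class with the same integral lattice (T0 = E-span of two rho-positive diagonal
vectors), so the card's 'component matching' crux dissolves into CMAnchor (support).
RANKED CRUXES. r2 IsogenyInvariance [typed]: HC(S1×S1) for (S1,J1) exact+TC whenever (H^2(S1),J1) is
E-isometric (scale pinned by the integral H^4) to (H^2(S0),J0) with S0 a K3 of Picard number 18, J0
= +sqrt m on H^{2,0}(S0), HC(S0×S0): the transport principle = the node under which the two analytic
cruxes will be glued once the hyperkaehler layer is typed (it is Target-equivalent modulo the known
support items, by design). r2 CarrierStability [informal until definitions land]: at a Picard-18 CM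
anchor, for generic kappa_0 in E_+ ∩ Amp_R, a mu_{kappa_0 ⊠ kappa_0}-stable bundle F0 on S0×S0 with
c_1 = 0, c_2 = x[Δ] + y·J0 + z([pt×S0]+[S0×pt]), y ≠ 0 (NO NS⊗NS padding: it is killed at the first
NS = 0 node). r3 PicardSixteen [typed]: Target at Picard number 16 (dim_E T = 3, the 1-parameter RM
families of arXiv:2310.05196; open outside the two families of arXiv:2203.09778 Thm 0.2). r4
HyperholomorphicTransport [informal]: Verbitsky's theorem for the product hyperkaehler metric on
S_t×S_t, chains of E-twistor lines with NS = 0 nodes joining the anchor period to the target period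
inside D_E (connectivity with prescribed end 3-planes), constancy of c_2 and landing by GAGA.
SUPPORT (known, typed): CMAnchor (surjectivity of the K3 period map + E-linear algebra;
arXiv:2511.19970 §7, §11), HighPicardSquares (Picard ≥ 17 ⇒ End_Hdg(T) is Q or CM, arXiv:2203.09778
§0.3; CM ⇒ HC(S×S), arXiv:1510.02852 Cor., arXiv:1705.04063), LatticeEStructure (arXiv:2511.19970
Cor 11.4 with r_0 = 3, in 22×22 rational matrix form; explicit witness <sqrt m, sqrt m, sqrt m, -1/2
×8>: tr<sqrt m> = U, tr<-1/2> = <-1,-m>, <m>^8 ≅ <1>^8 by roundness of <1,1,1,1> — provable now),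
TargetOfHodgeConjecture and Assembly (both PROVED in Sketch.lean).
KILL CRITERIA. (a) A Voisin-type theorem "on a very general K3-type Kaehler surface M with NS = 0
and End_Hdg(H^2) = Q(sqrt m), every coherent sheaf / holomorphic bundle on M×M has c_2 with zero
J-component" kills CarrierStability, HyperholomorphicTransport and the line (and would itself be a
new Kaehler-barrier fact worth cataloguing). (b) A lattice/Hodge-theoretic proof that at Picard-18
anchors no mu-stable bundle has c_2 in Q[Δ] + Q·J0 + fibres with y ≠ 0 (e.g. a Bogomolov–type
inequality along E_+) kills the carrier. (c) Refutation of IsogenyInvariance or PicardSixteen = a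
counterexample to HC (closes the summit negatively).
DELIBERATELY NOT DECOMPOSED: the glue CarrierStability → HyperholomorphicTransport →
IsogenyInvariance (to be filed as a glued split when Literature/Geometry/Hyperkaehler notions —
hyperkaehler manifold + twistor family, slope stability w.r.t. a real Kaehler class, Chern classes
of holomorphic bundles on complex manifolds, hyperholomorphic connection — land; definition requests
filed); the no-effective-carrier lemma N0 (generic RM K3×K3 carries no analytic 2-cycle with a sqrt
m-component: finite ⇒ etale ⇒ automorphism ⇒ isometry) is recorded in the card, not itemised;
TC-removal via Hodge similitudes (open: Varesco) and the OG6/OG10 parity prediction are out of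
scope; products S×S' of E-Hodge-similar K3s follow from Target + Buskin and are not itemised.

Novelty: Delta: nobody has pointed twistor/hyperholomorphic transport at a NON-isometric Hodge endomorphism.
Nearest: Buskin arXiv:1510.02852 and Huybrechts arXiv:1705.04063 (rational Hodge ISOMETRIES
algebraic; CM ⇒ HC(S×S)); Huybrechts arXiv:1910.13788 §1 (on ORDINARY twistor lines the totally real
classes (S^2 T)^{2,2} do NOT deform — the obstruction removed here); Bayer-Fluckiger–van
Geemen–Schuett arXiv:2511.19970 Cor 11.4/Thm 7.1/Thm 1.3 and arXiv:2401.04072 (E-forms with transfer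
V_K3 and the 9-dim family of non-projective K3 with End = Q(sqrt m): the card's E-period domain is
established there, with no twistor or Hodge-conjecture content); Varesco arXiv:2203.09778 and
doi:10.1007/s00209-023-03390-8 (state of the art for RM K3 squares: Kuga–Satake/similitudes, Picard
16 only on two families); engine Verbitsky alg-geom/9307008 Thm 2.5, Markman
doi:10.1112/s0010437x24007048, modular/atomic sheaves arXiv:1912.02659, arXiv:2202.01184. The new
device: a self-adjoint E-structure J on ALL of H^2(S,Q) (possible because b_2 = 22 is even), twistor
lines with positive 3-plane inside the +sqrt(m)-eigenspace (irrational Kaehler class) so that J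
commutes with SU(2)_W and y·J + x[Δ] stays invariant on S_t×S_t, chains through NS = 0 K3 surfaces
where slope-stability is class-independent. Typed novelty: IsogenyInvariance = algebraicity of real
multiplication is an invariant of the E-isometry class of (H^2(S,Q), q, J), generalising
Buskin/Huybrechts from Hodge isometries to arbitrary E-isometrie  [refs: 10.1007/s00209-023-03390-8, 10.1112/s0010437x24007048, 1510.02852, 1705.04063, 1910.13788, 2511.19970, 2401.04072, 2203.09778, 1912.02659, 2202.01184, 2501.02315, doi:10.1007/s00209-023-03390-8, doi:10.1112/s0010437x24007048]

Barriers (technique_class: twistor-transport, hyperholomorphic-sheaves): technique_class: twistor-transport, hyperholomorphic-sheaves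
- Literature.Barriers.HodgeConjecture.Zucker1977_kaehlerTorus_noAnalyticCycles (kaehler-methods):
non-projective K3 surfaces are used only as a ROAD; the conclusion is drawn at the projective
endpoint S×S by GAGA/Chow (c_2 of an algebraic bundle is algebraic). The barrier bites exactly on
carriers: on a generic RM K3×K3 no analytic 2-cycle carries the sqrt(m)-class (lemma N0 of the card:
finite ⇒ etale ⇒ graph of an automorphism ⇒ isometry), which is WHY bundles of rank ≥ 2 are
transported, as in Buskin's proof for isometries.
- Literature.Barriers.HodgeConjecture.Voisin2002_weilTorus_hodgeClassWithoutSubvarieties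
(chern-classes-of-coherent-sheaves, holomorphic-vector-bundles): the model refutation. Voisin's
vanishing c_2(F) = 0 needs (a) NS = 0, (b) no positive-dimensional proper analytic subsets, (c)
Hdg^4 ⟂ [omega]^{n-2}; on M = S_t×S_t (S_t a K3 with NS = 0) (b) fails (fibres, diagonal, graphs)
and (c) fails ([Δ]·omega^2 = 4 kappa^2 > 0), and indeed c_2(I_Δ) = [Δ] ≠ 0 — so the theorem does not
apply; a Voisin-TYPE statement 'every sheaf on generic E-K3×E-K3 has c_2 with zero J-component' is
named as kill criterion (a) and would be a new barrier fact. At the projective endpoint Chern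
classes of holomorphic bundles ARE algebraic (Deligne2000 §2 (ii)).
- Literature.Barriers.HodgeConjecture.AtiyahHirzebruch1962_torsionClass_notAlgebraic and
Literature.Barriers.HodgeConjecture.Kollar1992_nonTorsionClass_notAlgebraic

Novelty grade: new-combination — REVIEW (rreview-3539e784; route already CLOSED retired by operator 13:48Z, note filed for the record). Elaborates rc0 (all 8 typed decls). K3 clause faithful (HodgeModel pinned by IsAnalytification; nowhere-zero holomorphic 2-form + b1=0). E-structure algebra re-derived: J rational, cup-self-adjoint (refuter refuter-rreview-route-HodgeConjecture-Ev-3539e784-0, 2026-08-15T13:59:03Z; prior: arXiv:2304.02519, arXiv:2203.09778, arXiv:1510.02852, arXiv:1705.04063, arXiv:1910.13788, doi:10.1112/s0010437x24007048, arXiv:2511.19970, arXiv:2310.05196)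

History (route lifecycle, newest last):
- 2026-08-15T11:16:19Z · rev 1: dropped stmt-HodgeConjecture-3288 — drop duplicate informal item 3288 = 3273 CarrierStability (CLI retry artefact); 3273/3274 are the intended informal cruxes (planner-plancard-HodgeConjecture-HodgeConject-504ab3aa-0)
- 2026-08-15T13:48:14Z · CLOSED retired — not-a-thesis: assembly does not conclude the sub-problem Statement (operator:999:1257524)

sub-problem: HodgeConjecture · status: closed(retired) · opened planner-plancard-HodgeConjecture-HodgeConject-504ab3aa-0 2026-08-15T11:13:44Z · rev 2 · ledger route-HodgeConjecture-EvenB2Twistor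
GENERATED by the gate from the ledger (D-0016/17). Provers cite these decls: `theorem foo : Summit.HodgeConjecture.HodgeConjecture.Theses.EvenB2Twistor.<Decl> := …` in Summits/HodgeConjecture/HodgeConjecture/Theorems/<Name>.lean.
-/

namespace Summit.HodgeConjecture.HodgeConjecture.Theses.EvenB2Twistor

open scoped BigOperators Topology Manifold Classical MeasureTheory ProbabilityTheory Matrix InnerProductSpace ComplexConjugate ContinuousMap
open Filter Set Function TopologicalSpace MeasureTheory

attribute [summit_statement] _root_.HodgeConjecture

/-- item stmt-HodgeConjecture-3238 · target · rank 0 · closed · moot by None · by planner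
why it might fail: Equivalent to HC for these K3 squares: false iff some exact-RM K3 carries a non-algebraic sqrt(m)-class (K3 analogue of Weil's exceptional classes); nothing known beyond CM (Buskin/Huybrechts) and two Picard-16 families (Varesco 2203.09778).
sources: arXiv:2203.09778, doi:10.1007/s00209-023-03390-8, arXiv:math/0609839, arXiv:1510.02852, arXiv:1705.04063
[target] X: for every complex projective K3 surface S (smooth projective surface, H^1 = 0,
nowhere-vanishing holomorphic 2-form on a Hodge model) and every E-structure J on H^2(S,Q)
(rational, cup-self-adjoint, J(Jc) = m c with m non-square, +sqrt(m) on H^{2,0}) satisfying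
exactness EX (End_Hdg(T(S)) = Q + Q J|_T modulo NS: real multiplication by exactly Q(sqrt m)) and
the transfer condition TC (some J w + sqrt(m) w, w in NS_Q, has positive square, measured against
sigma·conj(sigma)), HodgeConjectureFor 4 (S ⊗ S). Scope = all quadratic-RM K3 squares whose NS_Q is
an E-transfer form with a positive eigenvector (TC can fail, e.g. Picard number 2 unless -disc(NS)/m
is a norm from E). Equivalent to algebraicity of the Kuenneth class of sqrt(m); open beyond CM and
two Picard-16 families. -/
@[route_item "route-HodgeConjecture-EvenB2Twistor"]
def Target : Prop :=
  ∀ (S : Literature.AlgebraicGeometry.Motives.SchemeOver ℂ), (Literature.AlgebraicGeometry.Motives.IsSmoothProjective 2 S ∧ Subsingleton (Literature.AlgebraicGeometry.HodgeTheory.complexBetti S 1) ∧ ∃ A : Literature.AlgebraicGeometry.HodgeTheory.HodgeModel 2 S, ∃ η : Literature.Geometry.Kaehler.MForm 𝓘(ℝ, A.model) A.carrier ℂ 2, Literature.Geometry.Kaehler.IsHolomorphicInCharts η ∧ ∀ x, η x ≠ 0) → ∀ m : ℕ, ¬ IsSquare m → ∀ J : Literature.AlgebraicGeometry.HodgeTheory.complexBetti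 S 2 →ₗ[ℂ] Literature.AlgebraicGeometry.HodgeTheory.complexBetti S 2, ((∀ c, Literature.AlgebraicGeometry.HodgeTheory.IsRationalClass c → Literature.AlgebraicGeometry.HodgeTheory.IsRationalClass (J c)) ∧ (∀ c, J (J c) = (m : ℂ) • c) ∧ (∀ a b, Literature.AlgebraicTopology.SingularHomology.cupProduct rfl (J a) b = Literature.AlgebraicTopology.SingularHomology.cupProduct rfl a (J b)) ∧ (∀ c, Literature.AlgebraicGeometry.HodgeTheory.IsOfHodgeType 2 S 2 2 0 c → J c = (Real.sqrt m : ℂ) • c)) → (∀ ψ : Literature.AlgebraicGeometry.HodgeTheory.complexBetti S 2 →ₗ[ℂ] Literature.AlgebraicGeometry.HodgeTheory.complexBetti S 2, (∀ c, Literature.AlgebraicGeometry.HodgeTheory.IsRationalClass c → Literature.AlgebraicGeometry.HodgeTheory.IsRationalClass (ψ c)) → (∀ p q c, Literature.AlgebraicGeometry.HodgeTheory.IsOfHodgeType 2 S 2 p q c → Literature.AlgebraicGeometry.HodgeTheory.IsOfHodgeType 2 S 2 p q (ψ c)) → ∃ a b : ℚ, ∀ v, (∀ w ∈ Literature.AlgebraicGeometry.HodgeTheory.algebraicClasses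 S 1, Literature.AlgebraicTopology.SingularHomology.cupProduct rfl v w = 0) → ψ v - ((a : ℂ) • v + (b : ℂ) • J v) ∈ Literature.AlgebraicGeometry.HodgeTheory.algebraicClasses S 1) → (∃ σ w : Literature.AlgebraicGeometry.HodgeTheory.complexBetti S 2, ∃ t : ℝ, Literature.AlgebraicGeometry.HodgeTheory.IsOfHodgeType 2 S 2 2 0 σ ∧ σ ≠ 0 ∧ Literature.AlgebraicGeometry.HodgeTheory.IsRationalClass w ∧ w ∈ Literature.AlgebraicGeometry.HodgeTheory.algebraicClasses S 1 ∧ 0 < t ∧ Literature.AlgebraicTopology.SingularHomology.cupProduct rfl (J w + (Real.sqrt m : ℂ) • w) (J w + (Real.sqrt m : ℂ) • w) = (t : ℂ) • Literature.AlgebraicTopology.SingularHomology.cupProduct rfl σ (Literature.AlgebraicGeometry.HodgeTheory.conjClass (Literature.AlgebraicGeometry.Motives.ComplexPoints S) 2 σ)) → Literature.AlgebraicGeometry.HodgeTheory.HodgeConjectureFor 4 (CategoryTheory.MonoidalCategoryStruct.tensorObj S S)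

/-- item stmt-HodgeConjecture-3239 · crux · rank 2 · closed · moot by None · by planner
why it might fail: Needs a mu-stable carrier with c_2 in Q[Delta]+Q·J0+fibres, y != 0, at Picard-18 anchors (no NS⊗NS padding survives the first NS=0 node) — may not exist (Bogomolov-type constraint along E_+, or a Voisin-type vanishing of the J-part of c_2 on generic E-K3×E-K3).
sources: arXiv:1510.02852, arXiv:alg-geom/9307008, arXiv:1910.13788, arXiv:2511.19970, Literature.Barriers.HodgeConjecture.Voisin2002_weilTorus_hodgeClassWithoutSubvarieties, arXiv:1912.02659
[crux] TRANSPORT PRINCIPLE — the typed node of the mechanism: if (S1,J1) [K3, E-structure, EX, TC]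
is E-isometric to (S0,J0) — g : H^2(S1,Q) -> H^2(S0,Q) rational both ways, g J1 = J0 g,
cup-compatible through an identification g4 of the H^4's that preserves INTEGRAL classes (pins the
scale: isometry, not similitude — Hodge similitudes are open) — where S0 is a K3 of Picard number
18, J0 = +sqrt(m) on H^{2,0}(S0) and HC(S0 x S0) holds, then HC(S1 x S1). Proof plan =
CarrierStability (stable F0 on S0 x S0, c_2 = x[Delta] + y J0 + z fibres) +
HyperholomorphicTransport (Verbitsky Thm 2.5 for product metrics along chains of E-twistor lines
with NS = 0 nodes, from sigma(S0) to the g-image of sigma(S1); the endpoint K3 S' is rationally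
HODGE-isometric to S1, hence related by an algebraic class, Buskin) + GAGA landing + Kuenneth
bookkeeping (EX makes y·sqrt(m) the only missing class). This decl is the parent under which those
steps are glued once the hyperkaehler layer is typed; by design it is Target-equivalent modulo the
known support items CMAnchor + HighPicardSquares (anchors always exist). -/
@[route_item "route-HodgeConjecture-EvenB2Twistor"]
def IsogenyInvariance : Prop :=
  ∀ (S₀ S₁ : Literature.AlgebraicGeometry.Motives.SchemeOver ℂ), (Literature.AlgebraicGeometry.Motives.IsSmoothProjective 2 S₀ ∧ Subsingleton (Literature.AlgebraicGeometry.HodgeTheory.complexBetti S₀ 1) ∧ ∃ A : Literature.AlgebraicGeometry.HodgeTheory.HodgeModel 2 S₀, ∃ η : Literature.Geometry.Kaehler.MForm 𝓘(ℝ, A.model) A.carrier ℂ 2, Literature.Geometry.Kaehler.IsHolomorphicInCharts η ∧ ∀ x, η x ≠ 0) → (Literature.AlgebraicGeometry.Motives.IsSmoothProjective 2 S₁ ∧ Subsingleton (Literature.AlgebraicGeometry.HodgeTheory.complexBetti S₁ 1) ∧ ∃ A : Literature.AlgebraicGeometry.HodgeTheory.HodgeModel 2 S₁, ∃ η : Literature.Geometry.Kaehler.MForm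 𝓘(ℝ, A.model) A.carrier ℂ 2, Literature.Geometry.Kaehler.IsHolomorphicInCharts η ∧ ∀ x, η x ≠ 0) → ∀ m : ℕ, ¬ IsSquare m → ∀ (J₀ : Literature.AlgebraicGeometry.HodgeTheory.complexBetti S₀ 2 →ₗ[ℂ] Literature.AlgebraicGeometry.HodgeTheory.complexBetti S₀ 2) (J₁ : Literature.AlgebraicGeometry.HodgeTheory.complexBetti S₁ 2 →ₗ[ℂ] Literature.AlgebraicGeometry.HodgeTheory.complexBetti S₁ 2), (∀ c, Literature.AlgebraicGeometry.HodgeTheory.IsOfHodgeType 2 S₀ 2 2 0 c → J₀ c = (Real.sqrt m : ℂ) • c) → ((∀ c, Literature.AlgebraicGeometry.HodgeTheory.IsRationalClass c → Literature.AlgebraicGeometry.HodgeTheory.IsRationalClass (J₁ c)) ∧ (∀ c, J₁ (J₁ c) = (m : ℂ) • c) ∧ (∀ a b, Literature.AlgebraicTopology.SingularHomology.cupProduct rfl (J₁ a) b = Literature.AlgebraicTopology.SingularHomology.cupProduct rfl a (J₁ b)) ∧ (∀ c, Literature.AlgebraicGeometry.HodgeTheory.IsOfHodgeType 2 S₁ 2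 2 0 c → J₁ c = (Real.sqrt m : ℂ) • c)) → Module.finrank ℂ (Literature.AlgebraicGeometry.HodgeTheory.algebraicClasses S₀ 1) = 18 → (∃ g : Literature.AlgebraicGeometry.HodgeTheory.complexBetti S₁ 2 ≃ₗ[ℂ] Literature.AlgebraicGeometry.HodgeTheory.complexBetti S₀ 2, ∃ g₄ : Literature.AlgebraicGeometry.HodgeTheory.complexBetti S₁ 4 ≃ₗ[ℂ] Literature.AlgebraicGeometry.HodgeTheory.complexBetti S₀ 4, (∀ c, Literature.AlgebraicGeometry.HodgeTheory.IsRationalClass c ↔ Literature.AlgebraicGeometry.HodgeTheory.IsRationalClass (g c)) ∧ (∀ c, g (J₁ c) = J₀ (g c)) ∧ (∀ a b, g₄ (Literature.AlgebraicTopology.SingularHomology.cupProduct rfl a b) = Literature.AlgebraicTopology.SingularHomology.cupProduct rfl (g a) (g b)) ∧ (∀ c, Literature.AlgebraicGeometry.HodgeTheory.IsIntegralClass c ↔ Literature.AlgebraicGeometry.HodgeTheory.IsIntegralClass (g₄ c))) → Literature.AlgebraicGeometry.HodgeTheory.HodgeConjectureFor 4 (CategoryTheory.MonoidalCategoryStruct.tensorObj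 S₀ S₀) → (∀ ψ : Literature.AlgebraicGeometry.HodgeTheory.complexBetti S₁ 2 →ₗ[ℂ] Literature.AlgebraicGeometry.HodgeTheory.complexBetti S₁ 2, (∀ c, Literature.AlgebraicGeometry.HodgeTheory.IsRationalClass c → Literature.AlgebraicGeometry.HodgeTheory.IsRationalClass (ψ c)) → (∀ p q c, Literature.AlgebraicGeometry.HodgeTheory.IsOfHodgeType 2 S₁ 2 p q c → Literature.AlgebraicGeometry.HodgeTheory.IsOfHodgeType 2 S₁ 2 p q (ψ c)) → ∃ a b : ℚ, ∀ v, (∀ w ∈ Literature.AlgebraicGeometry.HodgeTheory.algebraicClasses S₁ 1, Literature.AlgebraicTopology.SingularHomology.cupProduct rfl v w = 0) → ψ v - ((a : ℂ) • v + (b : ℂ) • J₁ v) ∈ Literature.AlgebraicGeometry.HodgeTheory.algebraicClasses S₁ 1) → (∃ σ w : Literature.AlgebraicGeometry.HodgeTheory.complexBetti S₁ 2, ∃ t : ℝ, Literature.AlgebraicGeometry.HodgeTheory.IsOfHodgeType 2 S₁ 2 2 0 σ ∧ σ ≠ 0 ∧ Literature.AlgebraicGeometry.HodgeTheory.IsRationalClass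 w ∧ w ∈ Literature.AlgebraicGeometry.HodgeTheory.algebraicClasses S₁ 1 ∧ 0 < t ∧ Literature.AlgebraicTopology.SingularHomology.cupProduct rfl (J₁ w + (Real.sqrt m : ℂ) • w) (J₁ w + (Real.sqrt m : ℂ) • w) = (t : ℂ) • Literature.AlgebraicTopology.SingularHomology.cupProduct rfl σ (Literature.AlgebraicGeometry.HodgeTheory.conjClass (Literature.AlgebraicGeometry.Motives.ComplexPoints S₁) 2 σ)) → Literature.AlgebraicGeometry.HodgeTheory.HodgeConjectureFor 4 (CategoryTheory.MonoidalCategoryStruct.tensorObj S₁ S₁)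

-- item stmt-HodgeConjecture-3273 · crux · rank 2 · closed · moot by None · by planner — informal only, no Lean statement yet:
--   [crux] CARRIER STABILITY AT CM ANCHORS (informal until the hyperkaehler/stability layer is typed;
--   definition requests filed). For every projective K3 surface S0 of Picard number 18 with an
--   E-structure J0 (rational, cup-self-adjoint, J0∘J0 = m, +sqrt(m) on H^{2,0}; HC(S0×S0) is known, so
--   J0 = Σ n_i [Z_i] with Z_i ⊂ S0×S0 algebraic surfaces) and for kappa_0 in a non-empty open subset of
--   E_+ ∩ Amp(S0)_R (E_+ = +sqrt(m)-eigenspace of J0 on H^2(S0,R); it has signature (1,8) on NS; generic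
--   kappa_0 satisfies kappa_0^⊥ ∩ NS(S0)_Q = 0), there is a holomorphic (= algebraic) vector bundle F0
--   on S0×S0 whi

/-- item stmt-HodgeConjecture-3240 · crux · rank 3 · closed · moot by None · by planner
why it might fail: Outside the Schlickewei/ILP families no method applies; a very general member of a 1-parameter RM family (arXiv:2310.05196) might carry a non-algebraic sqrt(m)-class, i.e. HC could already fail here; TC may moreover exclude some Picard-16 Neron–Severi lattices.
sources: arXiv:2203.09778, arXiv:2310.05196, doi:10.1007/s00209-023-03390-8
[crux] FIRST OPEN CASE — Target restricted to Picard number 16 (rank T = 6, dim_E T = 3: the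
one-parameter RM families of van Geemen–Schuett arXiv:2310.05196 and the Elsenhans–Jahnel double
sextics). Known only for the two 4-dimensional families with algebraic Kuga–Satake correspondence
(double planes branched in six lines; desingularised 15-nodal quartics in P^4): Varesco
arXiv:2203.09778 Thm 0.2. Designated milestone for the carrier+transport mechanism (explicit anchors
and targets in the same 9-dim D_E) and for certified experiments on explicit RM K3 surfaces. -/
@[route_item "route-HodgeConjecture-EvenB2Twistor"]
def PicardSixteen : Prop :=
  ∀ (S : Literature.AlgebraicGeometry.Motives.SchemeOver ℂ), (Literature.AlgebraicGeometry.Motives.IsSmoothProjective 2 S ∧ Subsingleton (Literature.AlgebraicGeometry.HodgeTheory.complexBetti S 1) ∧ ∃ A : Literature.AlgebraicGeometry.HodgeTheory.HodgeModel 2 S, ∃ η : Literature.Geometry.Kaehler.MForm 𝓘(ℝ, A.model) A.carrier ℂ 2, Literature.Geometry.Kaehler.IsHolomorphicInCharts η ∧ ∀ x, η x ≠ 0) → Module.finrank ℂ (Literature.AlgebraicGeometry.HodgeTheory.algebraicClasses S 1) = 16 → ∀ m : ℕ, ¬ IsSquare m → ∀ J : Literature.AlgebraicGeometry.HodgeTheory.complexBetti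 S 2 →ₗ[ℂ] Literature.AlgebraicGeometry.HodgeTheory.complexBetti S 2, ((∀ c, Literature.AlgebraicGeometry.HodgeTheory.IsRationalClass c → Literature.AlgebraicGeometry.HodgeTheory.IsRationalClass (J c)) ∧ (∀ c, J (J c) = (m : ℂ) • c) ∧ (∀ a b, Literature.AlgebraicTopology.SingularHomology.cupProduct rfl (J a) b = Literature.AlgebraicTopology.SingularHomology.cupProduct rfl a (J b)) ∧ (∀ c, Literature.AlgebraicGeometry.HodgeTheory.IsOfHodgeType 2 S 2 2 0 c → J c = (Real.sqrt m : ℂ) • c)) → (∀ ψ : Literature.AlgebraicGeometry.HodgeTheory.complexBetti S 2 →ₗ[ℂ] Literature.AlgebraicGeometry.HodgeTheory.complexBetti S 2, (∀ c, Literature.AlgebraicGeometry.HodgeTheory.IsRationalClass c → Literature.AlgebraicGeometry.HodgeTheory.IsRationalClass (ψ c)) → (∀ p q c, Literature.AlgebraicGeometry.HodgeTheory.IsOfHodgeType 2 S 2 p q c → Literature.AlgebraicGeometry.HodgeTheory.IsOfHodgeType 2 S 2 p q (ψ c)) → ∃ a b : ℚ, ∀ v, (∀ w ∈ Literature.AlgebraicGeometry.HodgeTheory.algebraicClasses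 S 1, Literature.AlgebraicTopology.SingularHomology.cupProduct rfl v w = 0) → ψ v - ((a : ℂ) • v + (b : ℂ) • J v) ∈ Literature.AlgebraicGeometry.HodgeTheory.algebraicClasses S 1) → (∃ σ w : Literature.AlgebraicGeometry.HodgeTheory.complexBetti S 2, ∃ t : ℝ, Literature.AlgebraicGeometry.HodgeTheory.IsOfHodgeType 2 S 2 2 0 σ ∧ σ ≠ 0 ∧ Literature.AlgebraicGeometry.HodgeTheory.IsRationalClass w ∧ w ∈ Literature.AlgebraicGeometry.HodgeTheory.algebraicClasses S 1 ∧ 0 < t ∧ Literature.AlgebraicTopology.SingularHomology.cupProduct rfl (J w + (Real.sqrt m : ℂ) • w) (J w + (Real.sqrt m : ℂ) • w) = (t : ℂ) • Literature.AlgebraicTopology.SingularHomology.cupProduct rfl σ (Literature.AlgebraicGeometry.HodgeTheory.conjClass (Literature.AlgebraicGeometry.Motives.ComplexPoints S) 2 σ)) → Literature.AlgebraicGeometry.HodgeTheory.HodgeConjectureFor 4 (CategoryTheory.MonoidalCategoryStruct.tensorObj S S)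

-- item stmt-HodgeConjecture-3274 · crux · rank 4 · closed · moot by None · by planner — informal only, no Lean statement yet:
--   [crux] HYPERHOLOMORPHIC TRANSPORT ALONG E-TWISTOR CHAINS (informal until hyperkaehler manifold /
--   twistor family / slope stability / hyperholomorphic connection are typed). Let (Λ, q, J) be the K3
--   lattice with an E-structure (LatticeEStructure, CMAnchor) and D_E ⊂ {σ ∈ P(E_+ ⊗ C) : q(σ) = 0, q(σ,
--   σ̄) > 0} the E-period domain (E_+ of signature (3,8)). (i) CONNECTIVITY: for σ0, σ1 ∈ D_E and
--   positive 3-planes W0 ∋ P(σ0), W1 ∋ P(σ1) inside E_{+,R} with W_i^⊥ ∩ Λ_Q = 0 there is a chain of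
--   twistor conics C(W0), C(W'_1), …, C(W'_k), C(W1) in D_E whose consecutive members meet at nodes σ'
--   with NS(σ') =

/-- item stmt-HodgeConjecture-3241 · support · rank 9 · closed · moot by None · by planner
sources: arXiv:2511.19970, doi:10.1017/cbo9781316594193
[support] ANCHORS EXIST IN EVERY E-ISOMETRY CLASS (known mathematics, far from the tree): for
(S1,J1) K3 with E-structure and TC there is a projective K3 S0 of Picard number 18, J0 with +sqrt(m)
on H^{2,0}(S0), and an E-isometry (H^2(S1),J1) ≅ (H^2(S0),J0) with integral H^4-identification.
Sketch: Lambda := H^2(S1,Z) with J := J1; TC ⇒ the +sqrt(m)-eigenspace E_+ has signature (3,8);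
E-diagonalise and let T0 := E-span of two rho-positive basis vectors (T0 ∩ E_+ positive definite of
rank 2, T0 ∩ E_- negative definite); the isotropic sigma0 spanning (T0 ∩ E_+) ⊗ C lies in D_E,
NS(sigma0) = T0^⊥ ∩ Lambda_Q has rank 18 and signature (1,17) (projectivity); surjectivity of the K3
period map (Todorov; Huybrechts, Lectures on K3, Thm 7.4.1) gives S0 with H^2(S0,Z) ≅ Lambda and
period sigma0; J0 := J transported (Hodge since sigma0 ∈ D_E); g = the marking (even integral). Refs
arXiv:2511.19970 §7 and §11. -/
@[route_item "route-HodgeConjecture-EvenB2Twistor"]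
def CMAnchor : Prop :=
  ∀ (S₁ : Literature.AlgebraicGeometry.Motives.SchemeOver ℂ), (Literature.AlgebraicGeometry.Motives.IsSmoothProjective 2 S₁ ∧ Subsingleton (Literature.AlgebraicGeometry.HodgeTheory.complexBetti S₁ 1) ∧ ∃ A : Literature.AlgebraicGeometry.HodgeTheory.HodgeModel 2 S₁, ∃ η : Literature.Geometry.Kaehler.MForm 𝓘(ℝ, A.model) A.carrier ℂ 2, Literature.Geometry.Kaehler.IsHolomorphicInCharts η ∧ ∀ x, η x ≠ 0) → ∀ m : ℕ, ¬ IsSquare m → ∀ (J₁ : Literature.AlgebraicGeometry.HodgeTheory.complexBetti S₁ 2 →ₗ[ℂ] Literature.AlgebraicGeometry.HodgeTheory.complexBetti S₁ 2), ((∀ c, Literature.AlgebraicGeometry.HodgeTheory.IsRationalClass c → Literature.AlgebraicGeometry.HodgeTheory.IsRationalClass (J₁ c)) ∧ (∀ c, J₁ (J₁ c) = (m : ℂ) • c) ∧ (∀ a b, Literature.AlgebraicTopology.SingularHomology.cupProduct rfl (J₁ a) b = Literature.AlgebraicTopology.SingularHomology.cupProduct rfl a (J₁ b)) ∧ (∀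 c, Literature.AlgebraicGeometry.HodgeTheory.IsOfHodgeType 2 S₁ 2 2 0 c → J₁ c = (Real.sqrt m : ℂ) • c)) → (∃ σ w : Literature.AlgebraicGeometry.HodgeTheory.complexBetti S₁ 2, ∃ t : ℝ, Literature.AlgebraicGeometry.HodgeTheory.IsOfHodgeType 2 S₁ 2 2 0 σ ∧ σ ≠ 0 ∧ Literature.AlgebraicGeometry.HodgeTheory.IsRationalClass w ∧ w ∈ Literature.AlgebraicGeometry.HodgeTheory.algebraicClasses S₁ 1 ∧ 0 < t ∧ Literature.AlgebraicTopology.SingularHomology.cupProduct rfl (J₁ w + (Real.sqrt m : ℂ) • w) (J₁ w + (Real.sqrt m : ℂ) • w) = (t : ℂ) • Literature.AlgebraicTopology.SingularHomology.cupProduct rfl σ (Literature.AlgebraicGeometry.HodgeTheory.conjClass (Literature.AlgebraicGeometry.Motives.ComplexPoints S₁) 2 σ)) → ∃ (S₀ : Literature.AlgebraicGeometry.Motives.SchemeOver ℂ) (J₀ : Literature.AlgebraicGeometry.HodgeTheory.complexBetti S₀ 2 →ₗ[ℂ] Literature.AlgebraicGeometry.HodgeTheory.complexBetti S₀ 2),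 (Literature.AlgebraicGeometry.Motives.IsSmoothProjective 2 S₀ ∧ Subsingleton (Literature.AlgebraicGeometry.HodgeTheory.complexBetti S₀ 1) ∧ ∃ A : Literature.AlgebraicGeometry.HodgeTheory.HodgeModel 2 S₀, ∃ η : Literature.Geometry.Kaehler.MForm 𝓘(ℝ, A.model) A.carrier ℂ 2, Literature.Geometry.Kaehler.IsHolomorphicInCharts η ∧ ∀ x, η x ≠ 0) ∧ (∀ c, Literature.AlgebraicGeometry.HodgeTheory.IsOfHodgeType 2 S₀ 2 2 0 c → J₀ c = (Real.sqrt m : ℂ) • c) ∧ Module.finrank ℂ (Literature.AlgebraicGeometry.HodgeTheory.algebraicClasses S₀ 1) = 18 ∧ (∃ g : Literature.AlgebraicGeometry.HodgeTheory.complexBetti S₁ 2 ≃ₗ[ℂ] Literature.AlgebraicGeometry.HodgeTheory.complexBetti S₀ 2, ∃ g₄ : Literature.AlgebraicGeometry.HodgeTheory.complexBetti S₁ 4 ≃ₗ[ℂ] Literature.AlgebraicGeometry.HodgeTheory.complexBetti S₀ 4, (∀ c, Literature.AlgebraicGeometry.HodgeTheory.IsRationalClass c ↔ Literature.AlgebraicGeometry.HodgeTheory.IsRationalClass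 (g c)) ∧ (∀ c, g (J₁ c) = J₀ (g c)) ∧ (∀ a b, g₄ (Literature.AlgebraicTopology.SingularHomology.cupProduct rfl a b) = Literature.AlgebraicTopology.SingularHomology.cupProduct rfl (g a) (g b)) ∧ (∀ c, Literature.AlgebraicGeometry.HodgeTheory.IsIntegralClass c ↔ Literature.AlgebraicGeometry.HodgeTheory.IsIntegralClass (g₄ c)))

/-- item stmt-HodgeConjecture-3242 · support · rank 9 · closed · moot by None · by planner
sources: arXiv:1510.02852, arXiv:1705.04063, arXiv:2203.09778, doi:10.1515/crll.1983.341.193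
[support] KNOWN: HC(S x S) for projective K3 S of Picard number ≥ 17. Then rank T(S) ≤ 5, so
End_Hdg(T) is Q (real multiplication needs dim_E T ≥ 3) or a CM field (arXiv:2203.09778 §0.3; Zarhin
doi:10.1515/crll.1983.341.193); case Q: id_T = [Delta] − (NS-part) − fibres is algebraic; case CM:
Buskin arXiv:1510.02852 Cor. / Huybrechts arXiv:1705.04063 (a CM field is spanned by Hodge
isometries). Plus Kuenneth + Lefschetz (1,1) bookkeeping on H^4(S x S). Supplies HC(S0 x S0) for the
Picard-18 anchors in the Assembly; shareable with every K3-square route. -/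
@[route_item "route-HodgeConjecture-EvenB2Twistor"]
def HighPicardSquares : Prop :=
  ∀ (S : Literature.AlgebraicGeometry.Motives.SchemeOver ℂ), (Literature.AlgebraicGeometry.Motives.IsSmoothProjective 2 S ∧ Subsingleton (Literature.AlgebraicGeometry.HodgeTheory.complexBetti S 1) ∧ ∃ A : Literature.AlgebraicGeometry.HodgeTheory.HodgeModel 2 S, ∃ η : Literature.Geometry.Kaehler.MForm 𝓘(ℝ, A.model) A.carrier ℂ 2, Literature.Geometry.Kaehler.IsHolomorphicInCharts η ∧ ∀ x, η x ≠ 0) → 17 ≤ Module.finrank ℂ (Literature.AlgebraicGeometry.HodgeTheory.algebraicClasses S 1) → Literature.AlgebraicGeometry.HodgeTheory.HodgeConjectureFor 4 (CategoryTheory.MonoidalCategoryStruct.tensorObj S S)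

/-- item stmt-HodgeConjecture-3243 · support · rank 9 · closed · moot by None · by planner
sources: arXiv:2511.19970
[support] E-STRUCTURE ON THE RATIONAL K3 FORM (Bayer-Fluckiger–van Geemen–Schuett arXiv:2511.19970
Cor 11.4 with r_0 = 3), in 22x22 matrix form: for non-square m there is Jm ∈ M_22(Q) with Jm^2 =
m·1, self-adjoint for D = diag(1,1,1,-1,…,-1) (≅ II_{3,19} ⊗ Q, as E_8 ⊗ Q ≅ <1>^8), whose
−sqrt(m)-eigenspace in R^22 is negative definite (hence the +sqrt(m)-eigenspace has signature
(3,8)). PROVABLE NOW by an explicit witness: over E take H = <sqrt m, sqrt m, sqrt m, −1/2 ×8>;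
tr<sqrt m> = hyperbolic plane, tr<−1/2> = <−1, −m>, and <m>^8 ≅ <1>^8 over Q (m is a sum of four
squares and <1,1,1,1> is round), so tr H ≅ D; Jm = multiplication by sqrt m written in a rational
basis. Grounds the E-period domain D_E (signature (3,8)) of the thesis. -/
@[route_item "route-HodgeConjecture-EvenB2Twistor"]
def LatticeEStructure : Prop :=
  ∀ m : ℕ, ¬ IsSquare m → ∃ Jm : Matrix (Fin 22) (Fin 22) ℚ, Jm * Jm = (m : ℚ) • (1 : Matrix (Fin 22) (Fin 22) ℚ) ∧ Jm.transpose * Matrix.diagonal (fun i : Fin 22 => if i.val < 3 then (1 : ℚ) else -1) = Matrix.diagonal (fun i : Fin 22 => if i.val < 3 then (1 : ℚ) else -1) * Jm ∧ ∀ v : Fin 22 → ℝ, v ≠ 0 → (Jm.map (fun x : ℚ => (x : ℝ))).mulVec v = (-(Real.sqrt m)) • v → dotProduct v ((Matrix.diagonal (fun i : Fin 22 => if i.val < 3 then (1 : ℝ) else -1)).mulVec v) < 0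

/-- item stmt-HodgeConjecture-3244 · support · rank 9 · closed · moot by None · by planner
sources: Deligne2000
[support] FRAME: HodgeConjecture → Target (X is an instance family of the summit: S ⊗ S is smooth
projective of dimension 2+2 by
Literature.AlgebraicGeometry.Motives.IsSmoothProjective.tensor_holds). PROVED in the planner's
Sketch.lean (theorem frame_holds, attached as evidence); a prover can land it verbatim in Theorems/. -/
@[route_item "route-HodgeConjecture-EvenB2Twistor"]
def TargetOfHodgeConjecture : Prop :=
  HodgeConjecture → Target

/-- item stmt-HodgeConjecture-3245 · assembly · rank 1 · closed · moot by None · by planner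
[assembly] IsogenyInvariance → CMAnchor → HighPicardSquares → Target: given (S,J) with K3,
E-structure, EX, TC take the anchor (S0,J0) from CMAnchor, get HC(S0 x S0) from HighPicardSquares
(17 ≤ 18) and apply IsogenyInvariance. Pure logic; PROVED in the planner's Sketch.lean (theorem
assembly_holds, attached as evidence). -/
@[route_item "route-HodgeConjecture-EvenB2Twistor"]
def Assembly : Prop :=
  IsogenyInvariance → CMAnchor → HighPicardSquares → Target

end Summit.HodgeConjecture.HodgeConjecture.Theses.EvenB2Twistor
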